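import Mathlib
import Summits.ResolutionOfSingularities.ResolutionOfSingularities.Theorems.HomologicalConductorPersistenceSurfaceCompletedStepLevelFree
import Summits.ResolutionOfSingularities.ResolutionOfSingularities.Theorems.HomologicalConductorPersistenceDimOne
import HarnessLib

/-!
# Rung S-2 `PersistenceSurface` — the Sat₄ residual, FOURTH CUT: the LAST-SINGULAR-STEP EXEMPTION

Route `ResolutionOfSingularities/HomologicalConductor`, chain W4.4b (cell `res-hironaka`), rung S-2
`PersistenceSurface` (stmt-ResolutionOfSingularities-19970); o9/o11/o12 lineage, res-type-011 (offer o12‴,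
2026-08-27T10:09Z).  [OURS · L1 w44b; AI-written, weaker than expert review; NOT a statement of the manuscript
under study (Hironaka 2017), and no statement of that manuscript is used.]

The doors of record (`persistenceSurface_of_residual₃_of_levelFour`, p518900;
`persistenceSurface_of_residual₃_of_completedStep'_of_rest'`, p521182) demand the saturation `ca(T_m) ⊆ ca⁴(T_m)`
at EVERY residual stage.  But the rung's step `m` — `ca(T_m) ⊆ ca(T_(m+1))` — needs nothing at all when the
SUCCESSOR stage `T_(m+1)` is a regular local ring: then `ca(T_(m+1)) = T_(m+1) ⊇ T_m ⊇ ca(T_m)` (the rung S-1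
pattern, `PersistenceDimOne.ca_eq_self_of_isRegularLocalRing`).  And `T_(m+1)` IS regular whenever `T_m` is a
singular stage of Krull dimension `≤ 1` (Krull–Akizuki; p-lineage `StrictDrop.Birth.DimLEOne.stub_dimLEOne_succ_regular`
fed by `StrictDrop.Birth.TowerShape.stub_towerShape` — stage-level, no hypothesis on `dim A`), or regular
(`NoZeno.Birth.tower_succ_eq_self_of_isRegularLocalRing`).  Hence the third residual over-demands at
(i) every singular ONE-dimensional stage (for `dim A = 2`: stage `0` at a centre of `O` of height `1`, the local
ring of the surface along a singular curve — not regular, not a monic-hypersurface localisation over `k[x,y]`,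
not an edim-candidate for `d = 2`), and (ii) every LAST singular stage of a tower.  This file removes both:

* `isRegularLocalRing_succ_of_ringKrullDim_le_one` — any `dim A`: `dim T_m ≤ 1 ⇒ T_(m+1)` regular;
  `ca_subset_ca_succ_of_isRegularLocalRing_succ` — `T_(m+1)` regular ⇒ `ca(T_m) ⊆ ca(T_(m+1))`;
  `ringKrullDim_eq_two_of_not_isRegularLocalRing_succ` — `dim A ≤ 2`, `T_(m+1)` singular ⇒ `dim T_m = 2`;
* `@[conjecture] SaturationFourSurfaceResidual₄` — o3's binders VERBATIM, Residual₃'s three clauses VERBATIM, plus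
  TWO more: `¬ IsRegularLocalRing ↥(tower A (m + 1))` («the successor is singular too») and — a consequence, handed
  to the prover of the conjecture as a hypothesis — `ringKrullDim ↥(tower A m) = 2`;
  `saturationFourSurfaceResidual₄_of_residual₃` (free comparison);
* DOORS, re-proved STEP-WISE (a regular successor closes the step; otherwise o9d / o9h / the residual give
  `Sat₄(T_m)` and the levelled transfer finishes): `persistenceSurface_of_residual₄_of_levelFour'`
  (`Residual₄ → LevelFourPersistenceSurface' → PersistenceSurface`), `persistenceSurface_of_residual₄_of_levelFour`,
  `persistenceSurface_of_residual₄_of_completedStep'_of_rest'`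
  (`Residual₄ → CSP‴ → LevelFourPersistenceNonnormalOrNonrational' → PersistenceSurface`),
  `persistenceSurface_of_residual₄_of_completedStep_of_rest`.

NET reading of (C1): «`ca ⊆ ca⁴` at the TWO-dimensional stages of embedding dimension `≥ 4` (normal, or the
non-normal stage `0`) WHOSE SUCCESSOR IS STILL SINGULAR».

ERRATUM to p521182 (res-L1-w44b-tri-1, VACUITY-o12 2026-08-27T10:15Z, remark (b)): the docstring sentence of
`LevelFourPersistenceNonnormalOrNonrational'` «a failure here would NOT refute `PersistenceSurface`» was carried over
from the UNPRIMED o6b form (target `ca⁴(T_(m+1))`) and is wrong for the primed form: since `ca⁴(T_m) ⊆ ca(T_m)`, an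
`x ∈ ca⁴(T_m) ∖ ca(T_(m+1))` on a tower with the rung's binders IS a counterexample to `PersistenceSurface` (it would
not touch the (R♮) part).  The declaration itself is as intended; only that sentence is withdrawn here.

References: H. Matsumura, *Commutative Ring Theory*,
Thm. 11.7 (Krull–Akizuki) [`Matsumura1987`]; S. B. Iyengar, R. Takahashi, IMRN 2016, Example 2.5
[`IyengarTakahashi2014`] — both used only through landed tree lemmas.
-/

noncomputable section

-- single-problem summit: the doubled namespace component `ResolutionOfSingularities` is forced
set_option linter.dupNamespace false

namespace Summit.ResolutionOfSingularities.ResolutionOfSingularities.Theorems.HomologicalConductor.PersistenceSurfaceSaturationResidualFour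

open Summit.ResolutionOfSingularities.ResolutionOfSingularities.Theorems
open Summit.ResolutionOfSingularities.ResolutionOfSingularities.Theorems.HomologicalConductor.PersistenceSurfaceTowerDim
open Summit.ResolutionOfSingularities.ResolutionOfSingularities.Theorems.NoZeno.Birth
open Summit.ResolutionOfSingularities.ResolutionOfSingularities.Theorems.HomologicalConductor.PersistenceSurfaceLevelFour
open Summit.ResolutionOfSingularities.ResolutionOfSingularities.Theorems.HomologicalConductor.PersistenceSurfaceNormalPartition
open Summit.ResolutionOfSingularities.ResolutionOfSingularities.Theorems.HomologicalConductor.PeriodicSaturationStage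
open Summit.ResolutionOfSingularities.ResolutionOfSingularities.Theorems.HomologicalConductor.PersistenceSurfaceSaturationResidual
open Summit.ResolutionOfSingularities.ResolutionOfSingularities.Theorems.HomologicalConductor.PersistenceSurfaceSaturationResidualTwo
open Summit.ResolutionOfSingularities.ResolutionOfSingularities.Theorems.HomologicalConductor.PersistenceSurfaceSaturationResidualThree
open Summit.ResolutionOfSingularities.ResolutionOfSingularities.Theorems.HomologicalConductor.PersistenceSurfaceCompletedStep
open Summit.ResolutionOfSingularities.ResolutionOfSingularities.Theorems.HomologicalConductor.PersistenceSurfaceCompletedStepLevelFree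
open Summit.ResolutionOfSingularities.ResolutionOfSingularities.Theorems.HomologicalConductor.PersistenceDimOne

variable {k K : Type} [Field k] [Field K] [Algebra k K]

/-! ## Stage lemmas: a regular successor closes the step -/

/-- **A stage of Krull dimension `≤ 1` is followed by a REGULAR stage — for any `dim A`.**  If `T_m` is
regular the tower is stationary (`tower_succ_eq_self_of_isRegularLocalRing`); if `T_m` is singular of dimension
`≤ 1`, Krull–Akizuki (p-lineage `StrictDrop.Birth.DimLEOne.stub_dimLEOne_succ_regular`, with the tower shape
`StrictDrop.Birth.TowerShape.stub_towerShape`) makes `T_(m+1)` a normal noetherian local domain of dimension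
`≤ 1`, hence regular.  (Rung S-1 `PersistenceDimOne` is the case `dim A ≤ 1`; here the hypothesis is on the
stage.) [cite: Matsumura1987, Thm. 11.7] -/
theorem isRegularLocalRing_succ_of_ringKrullDim_le_one {p : ℕ} (hp : p.Prime) [CharP k p]
    (O : ValuationSubring K) (A : Subalgebra k K) (hk : ∀ c : k, algebraMap k K c ∈ O) (hA : A.FG)
    (hfr : IsFractionRing ↥A K) (hAO : A.toSubring ≤ O.toSubring) (m : ℕ)
    (hdim : ringKrullDim ↥(tower O A m) ≤ 1) : IsRegularLocalRing ↥(tower O A (m + 1)) := by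
  by_cases hreg : IsRegularLocalRing ↥(tower O A m)
  · rw [tower_succ_eq_self_of_isRegularLocalRing O A hk hfr hAO m hreg]
    exact hreg
  · have hshape := StrictDrop.Birth.TowerShape.stub_towerShape p hp k K O A hk hA hfr hAO
    exact StrictDrop.Birth.DimLEOne.stub_dimLEOne_succ_regular p hp k K O A hk hA hfr hAO
      hshape m hdim hreg

/-- **A regular successor closes the step**: if `T_(m+1)` is a regular local ring then
`ca(T_m) ⊆ ca(T_(m+1))` — `ca(T_(m+1)) = T_(m+1)` ([IyengarTakahashi2014, Example 2.5],
`PersistenceDimOne.ca_eq_self_of_isRegularLocalRing`) and `ca(T_m) ⊆ T_m ≤ T_(m+1)`. [folklore] -/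
theorem ca_subset_ca_succ_of_isRegularLocalRing_succ (O : ValuationSubring K) (A : Subalgebra k K)
    (m : ℕ) (hreg : IsRegularLocalRing ↥(tower O A (m + 1))) :
    ca (tower O A m) ⊆ ca (tower O A (m + 1)) := by
  rw [ca_eq_self_of_isRegularLocalRing (tower O A (m + 1)) hreg]
  intro x hx
  have hxT : x ∈ tower O A m := ca_subset _ hx
  rw [tower_succ]
  exact SyzygyFlattening.self_le_locAt O _ (SyzygyFlattening.self_le_nrm _
    (Algebra.subset_adjoin (Or.inl hxT)))

/-- **Under `dim A ≤ 2`, a stage with a SINGULAR successor has Krull dimension exactly `2`**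
(`dim T_m ≤ dim A ≤ 2`, o9d `ringKrullDim_tower_le_of_ringKrullDim_le`; `dim T_m ≤ 1` would make `T_(m+1)`
regular). Recorded for the vacuity reading of `SaturationFourSurfaceResidual₄`. [folklore] -/
theorem ringKrullDim_eq_two_of_not_isRegularLocalRing_succ {p : ℕ} (hp : p.Prime) [CharP k p]
    (O : ValuationSubring K) (A : Subalgebra k K) (hk : ∀ c : k, algebraMap k K c ∈ O) (hA : A.FG)
    (hfr : IsFractionRing ↥A K) (hAO : A.toSubring ≤ O.toSubring) (hdimA : ringKrullDim ↥A ≤ 2) (m : ℕ)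
    (hsucc : ¬ IsRegularLocalRing ↥(tower O A (m + 1))) : ringKrullDim ↥(tower O A m) = (2 : ℕ) := by
  haveI := hfr
  have hle2 : ringKrullDim ↥(tower O A m) ≤ (2 : ℕ) := ringKrullDim_tower_le_of_ringKrullDim_le O A hA hdimA m
  obtain ⟨d, hd, hd2⟩ := exists_ringKrullDim_eq_nat (d := 2) hle2
  have hnot : ¬ ringKrullDim ↥(tower O A m) ≤ 1 := fun h =>
    hsucc (isRegularLocalRing_succ_of_ringKrullDim_le_one hp O A hk hA hfr hAO m h)
  rw [hd] at hnot ⊢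
  have hd1 : ¬ d ≤ 1 := fun h => hnot (by exact_mod_cast h)
  have : d = 2 := by omega
  rw [this]

/-! ## The fourth residual -/

/-- **`SaturationFourSurfaceResidual₄` (OURS · fourth cut, «last-singular-step exemption»)** — o3's
`SaturationFourSurface` (binders VERBATIM) with the conclusion `ca(T_m) ⊆ ca⁴(T_m)` demanded only at the stages
`T_m` that are NOT regular, NOT presented monic-hypersurface localisations over `k[x,y]`, NOT edim-candidates for
`d = 2` (Residual₃'s clauses VERBATIM) AND whose successor `T_(m+1)` is NOT regular either, AND (a consequence,
offered to the prover of the conjecture as a usable hypothesis: `ringKrullDim_eq_two_of_not_isRegularLocalRing_succ`)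
of Krull dimension exactly `2`.  For presented normal surface stages the reading is «two-dimensional, embedding
dimension `≥ 4`, and not resolved by the next normalised `ca`-blow-up in the direction of `O`».  NOT a statement of
the manuscript. [this work] -/
@[conjecture]
def SaturationFourSurfaceResidual₄ : Prop :=
  ∀ p : ℕ, p.Prime → ∀ (k K : Type) [Field k] [CharP k p] [Field K] [Algebra k K] (O : ValuationSubring K) (A : Subalgebra k K), (∀ c : k, algebraMap k K c ∈ O) → A.FG → IsFractionRing ↥A K → A.toSubring ≤ O.toSubring → ringKrullDim ↥A ≤ 2 → let caAt : ℕ → Subalgebra k K → Set K := fun n A => {x : K | ∃ hx : x ∈ A, ∀ i : ℕ, n ≤ i → ∀ (M N : ModuleCat.{0} ↥A), Module.Finite ↥A M → Module.Finite ↥A N → ∀ e : CategoryTheory.Abelian.Ext.{0} M N i, (⟨x, hx⟩ : ↥A) • e = 0}; let ca : Subalgebra k K → Set K := fun A => {x : K | ∃ hx : x ∈ A, ∃ n : ℕ, ∀ i : ℕ, n ≤ i → ∀ (M N : ModuleCat.{0} ↥A), Module.Finite ↥A M → Module.Finite ↥A N → ∀ e : CategoryTheory.Abelian.Ext.{0}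 M N i, (⟨x, hx⟩ : ↥A) • e = 0}; let loc : Subalgebra k K → Subalgebra k K := fun A => Algebra.adjoin k {y : K | ∃ a ∈ A, ∃ s ∈ A, s⁻¹ ∈ O ∧ y = a * s⁻¹}; let chart : Subalgebra k K → Subalgebra k K := fun A => Algebra.adjoin k ((A : Set K) ∪ {y : K | ∃ c ∈ ca A, ∃ x ∈ ca A, x ≠ 0 ∧ (∀ c' ∈ ca A, c' * x⁻¹ ∈ O) ∧ y = c * x⁻¹}); let nrm : Subalgebra k K → Subalgebra k K := fun B => Algebra.adjoin k {y : K | IsIntegral ↥B y}; let tower : Subalgebra k K → ℕ → Subalgebra k K := fun A m => @Nat.rec (fun _ => Subalgebra k K) (loc A) (fun _ B => loc (nrm (chart B))) m; ∀ m : ℕ, ¬ IsRegularLocalRing ↥(tower A m) → ¬ IsMonicHypersurfaceLocalization k 2 ↥(tower A m) → ¬ IsEdimHypersurfaceCandidate 2 ↥(tower A m) → ¬ IsRegularLocalRing ↥(tower A (m + 1)) → ringKrullDim ↥(tower A m) = (2 : ℕ) → ca (tower A m) ⊆ caAt 4 (tower A m)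

/-- Free comparison: `SaturationFourSurfaceResidual₃ → SaturationFourSurfaceResidual₄`. [folklore] -/
theorem saturationFourSurfaceResidual₄_of_residual₃ (h : SaturationFourSurfaceResidual₃) :
    SaturationFourSurfaceResidual₄ := by
  intro p hp k K _ _ _ _ O A hk hA hfr hAO hdim caAt ca loc chart nrm tower m hreg hmon hcand _ _ x hx
  exact h p hp k K O A hk hA hfr hAO hdim m hreg hmon hcand hx

/-- **`Sat₄(T_m)` at a stage with a singular successor, from the fourth residual**: a regular `T_m` would have a
regular successor (stationary tower); a monic-hypersurface localisation has `ca = ca³ ⊆ ca⁴` (o9d); an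
edim-candidate that is not regular is an abstract hypersurface, `ca = ca³ ⊆ ca⁴` (o9h/o9g); every other stage has
Krull dimension `2` (`ringKrullDim_eq_two_of_not_isRegularLocalRing_succ`) and is the residual hypothesis. [OURS] -/
theorem ca_subset_caAt_four_of_residual₄ (h : SaturationFourSurfaceResidual₄) {p : ℕ} (hp : p.Prime)
    [CharP k p] (O : ValuationSubring K) (A : Subalgebra k K) (hk : ∀ c : k, algebraMap k K c ∈ O)
    (hA : A.FG) (hfr : IsFractionRing ↥A K) (hAO : A.toSubring ≤ O.toSubring) (hdim : ringKrullDim ↥A ≤ 2)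
    (m : ℕ) (hsucc : ¬ IsRegularLocalRing ↥(tower O A (m + 1))) :
    ca (tower O A m) ⊆ {x : K | ∃ hx : x ∈ tower O A m, ∀ i : ℕ, 4 ≤ i →
      ∀ (M N : ModuleCat.{0} ↥(tower O A m)), Module.Finite ↥(tower O A m) M →
        Module.Finite ↥(tower O A m) N →
          ∀ e : CategoryTheory.Abelian.Ext.{0} M N i, (⟨x, hx⟩ : ↥(tower O A m)) • e = 0} := by
  intro x hx
  by_cases hreg : IsRegularLocalRing ↥(tower O A m)
  · exfalso
    apply hsucc
    rw [tower_succ_eq_self_of_isRegularLocalRing O A hk hfr hAO m hreg]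
    exact hreg
  · by_cases hmon : IsMonicHypersurfaceLocalization k 2 ↥(tower O A m)
    · exact ca_subset_caAt_of_isMonicHypersurfaceLocalization (tower O A m) hmon (by norm_num) hx
    · by_cases hcand : IsEdimHypersurfaceCandidate 2 ↥(tower O A m)
      · exact ca_subset_caAt_of_isRegularHypersurfaceQuotient (tower O A m)
          (isRegularHypersurfaceQuotient_of_candidate hcand hreg) (by norm_num) hx
      · exact h p hp k K O A hk hA hfr hAO hdim m hreg hmon hcand hsucc
          (ringKrullDim_eq_two_of_not_isRegularLocalRing_succ hp O A hk hA hfr hAO hdim m hsucc) hx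

/-! ## The doors, re-proved step-wise -/

/-- **THE STEP-WISE DOOR [OURS · o12‴]: `SaturationFourSurfaceResidual₄ → LevelFourPersistenceSurface' →
PersistenceSurface`.**  At step `m`: if `T_(m+1)` is regular the step is closed by
`ca_subset_ca_succ_of_isRegularLocalRing_succ`; otherwise `ca(T_m) ⊆ ca⁴(T_m)` by
`ca_subset_caAt_four_of_residual₄` and `ca⁴(T_m) ⊆ ca(T_(m+1))` by the levelled transfer `hL`. [OURS] -/
theorem persistenceSurface_of_residual₄_of_levelFour' (hS : SaturationFourSurfaceResidual₄)
    (hL : LevelFourPersistenceSurface') :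
    Summit.ResolutionOfSingularities.ResolutionOfSingularities.Theses.HomologicalConductor.PersistenceSurface := by
  intro p hp k K _ _ _ _ O A hk hA hfr hAO hdim ca loc chart nrm tower m x hx
  by_cases hsucc : IsRegularLocalRing ↥(NoZeno.Birth.tower O A (m + 1))
  · exact ca_subset_ca_succ_of_isRegularLocalRing_succ O A m hsucc hx
  · have hx4 := ca_subset_caAt_four_of_residual₄ hS hp O A hk hA hfr hAO hdim m hsucc hx
    exact hL p hp k K O A hk hA hfr hAO hdim m hx4

/-- The step-wise door with the UNPRIMED levelled transfer `LevelFourPersistenceSurface` (o3). [OURS] -/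
theorem persistenceSurface_of_residual₄_of_levelFour (hS : SaturationFourSurfaceResidual₄)
    (hL : LevelFourPersistenceSurface) :
    Summit.ResolutionOfSingularities.ResolutionOfSingularities.Theses.HomologicalConductor.PersistenceSurface :=
  persistenceSurface_of_residual₄_of_levelFour' hS (levelFourPersistenceSurface'_of_levelFour hL)

/-- **THE LEVEL-FREE DOOR on the fourth residual [OURS · o12‴]:**
`SaturationFourSurfaceResidual₄ → CompletedStepPersistenceRationalNormal' → LevelFourPersistenceNonnormalOrNonrational'
→ PersistenceSurface` (CSP‴ gives the transfer on (R♮), `levelFourPersistenceRationalNormal'_of_completedStep'`;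
L-other′ on the rest; excluded middle glues). Every premise is a typed Prop [OURS] carried as a hypothesis; nothing
is asserted. [OURS] -/
theorem persistenceSurface_of_residual₄_of_completedStep'_of_rest' (hS : SaturationFourSurfaceResidual₄)
    (hC : CompletedStepPersistenceRationalNormal') (hN : LevelFourPersistenceNonnormalOrNonrational') :
    Summit.ResolutionOfSingularities.ResolutionOfSingularities.Theses.HomologicalConductor.PersistenceSurface :=
  persistenceSurface_of_residual₄_of_levelFour' hS
    (levelFourPersistenceSurface'_of_rationalNormal'_of_rest'
      (levelFourPersistenceRationalNormal'_of_completedStep' hC) hN)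

/-- The door on the fourth residual with CSP″ and the unprimed complementary transfer (010's o12′ vocabulary).
[OURS] -/
theorem persistenceSurface_of_residual₄_of_completedStep_of_rest (hS : SaturationFourSurfaceResidual₄)
    (hC : CompletedStepPersistenceRationalNormal) (hN : LevelFourPersistenceNonnormalOrNonrational) :
    Summit.ResolutionOfSingularities.ResolutionOfSingularities.Theses.HomologicalConductor.PersistenceSurface :=
  persistenceSurface_of_residual₄_of_completedStep'_of_rest' hS (completedStep'_of_completedStep hC)
    (levelFourPersistenceNonnormalOrNonrational'_of_levelFour hN)

end Summit.ResolutionOfSingularities.ResolutionOfSingularities.Theorems.HomologicalConductor.PersistenceSurfaceSaturationResidualFour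

end
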